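import Mathlib
import Summits.Ventures.Crystal3D.Theorems.StickyWulffConstantTextureLiminfTentCurrency
import HarnessLib

/-!
# The tent certificate — bilayer bookkeeping of the local currency (eng g9)

Route `StickyWulffConstant` (`Summits/Ventures/Crystal3D`, cell `crystal3d-full`), support toward the crux
`TextureLiminf` (stmt-Ventures-19483), line TexShadow v6.2, stub `stub_barlowFreeCertificate` (the Barlow tent).
A Barlow stacking is fcc only bilayer by bilayer, so the tent certificate must be assembled slab by slab, and the
local currency of `…TentTablesLocal.lean` (`tentCostOn24_le`: every broken bond is charged `12` = `2+2` by its two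
tetrahedra `+ 4+4` by its two octahedra) must be split by bilayer: of the cells of ONE bilayer slab, an IN-PLANE
bond (both ends in the same close-packed layer) lies in exactly one tetrahedron and one octahedron (the other
tetrahedron and octahedron are in the neighbouring slab), an INTER-LAYER bond in two tetrahedra and two octahedra.
This file proves the refined table
`tentCostOn24 A U D O ≤ 6 · (#IP + 2 · #IL)` (`tentCostOn24_le_six_mul`)
for cell families `U, D, O` of the slab between the `(111)` layers `0` and `1` of the cubic model (up-tetrahedra
anchored in layer `0`, down-tetrahedra anchored in layer `1`, octahedra anchored in layer `0`) whose closed cells meet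
a set `V`, where `IP` / `IL` are the in-plane / inter-layer ordered broken bonds of `A` between layers `0, 1` whose
occupied end is within `√2` of `V` (`brokenNearIP`, `brokenNearIL`).  Summed over the bilayers of a stacking every
broken bond is then charged `6 + 6` (in-plane, from its two bilayers) or `12` (inter-layer, from its one bilayer),
i.e. `½` in units of `24` — the planner's «2 tets + 2 octs per bond» count (TexShadow v6.1 docstring of
`BarlowFreeCertificate`, WHY TRUE).  Ingredients: the slot sets of `…TentTablesLocal.lean` split by layer
(`decide` fibre counts) and its generic double count `sum_card_ovSlots_le`.
WHAT THIS IS NOT: the certificate; F-C1 not moved.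
-/

noncomputable section

namespace Summit.Ventures.Crystal3D.TentCertificate

open Finset Summit.Ventures.Crystal3D MeasureTheory
open Literature.Geometry.DiscreteGeometry (intVec intVec_apply)
open scoped RealInnerProductSpace

/-! ## Layers of the cell vertices and the split slot sets -/

/-- `(111)` layer index of a site (`⟪(1,1,1), fccPoint n⟫ = 2 · lay n`). -/
def lay (n : Site) : ℤ := n 0 + n 1 + n 2

/-- `lay` is additive. -/
theorem lay_add (a b : Site) : lay (a + b) = lay a + lay b := by
  simp [lay, Pi.add_apply]; ring

/-- Layer offsets of the up-tetrahedron vertices: `0, 1, 1, 1`. -/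
theorem lay_tetUpV (i : Fin 4) : lay (tetUpV i) = if i = 0 then 0 else 1 := by
  fin_cases i <;> simp [lay, tetUpV]

/-- Layer offsets of the down-tetrahedron vertices: `0, -1, -1, -1`. -/
theorem lay_tetDnV (i : Fin 4) : lay (tetDnV i) = if i = 0 then 0 else -1 := by
  fin_cases i <;> simp [lay, tetDnV]

/-- Layer offsets of the octahedron vertices. -/
def octLayer : Fin 6 → ℤ := ![0, 1, 1, 0, 1, 0]

/-- `lay (octV i) = octLayer i`. -/
theorem lay_octV (i : Fin 6) : lay (octV i) = octLayer i := by
  fin_cases i <;> simp [lay, octV, octLayer]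

/-- In-plane slot pairs of a tetrahedron (both slots among the three vertices of its layer triangle). -/
def slotsTetIn : Finset (Fin 4 × Fin 4) := slotsTet.filter fun s => s.1 ≠ 0 ∧ s.2 ≠ 0
/-- Inter-layer slot pairs of a tetrahedron (one slot is the apex). -/
def slotsTetX : Finset (Fin 4 × Fin 4) := slotsTet.filter fun s => ¬ (s.1 ≠ 0 ∧ s.2 ≠ 0)
/-- In-plane slot pairs of an octahedron in its lower layer. -/
def slotsOctLo : Finset (Fin 6 × Fin 6) := slotsOct.filter fun s => octLayer s.1 = 0 ∧ octLayer s.2 = 0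
/-- In-plane slot pairs of an octahedron in its upper layer. -/
def slotsOctUp : Finset (Fin 6 × Fin 6) := slotsOct.filter fun s => octLayer s.1 = 1 ∧ octLayer s.2 = 1
/-- Inter-layer slot pairs of an octahedron. -/
def slotsOctX : Finset (Fin 6 × Fin 6) := slotsOct.filter fun s => octLayer s.1 ≠ octLayer s.2

/-- Fibre count: each offset at most once among in-plane up-tetrahedron slots. -/
theorem fiber_slotsTetIn_up : ∀ δ ∈ fccOffsets, (slotsTetIn.filter fun s => tetUpV s.2 - tetUpV s.1 = δ).card ≤ 1 := by
  decide
/-- Fibre count: each offset at most once among inter-layer up-tetrahedron slots. -/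
theorem fiber_slotsTetX_up : ∀ δ ∈ fccOffsets, (slotsTetX.filter fun s => tetUpV s.2 - tetUpV s.1 = δ).card ≤ 1 := by
  decide
/-- Fibre count: each offset at most once among in-plane down-tetrahedron slots. -/
theorem fiber_slotsTetIn_dn : ∀ δ ∈ fccOffsets, (slotsTetIn.filter fun s => tetDnV s.2 - tetDnV s.1 = δ).card ≤ 1 := by
  decide
/-- Fibre count: each offset at most once among inter-layer down-tetrahedron slots. -/
theorem fiber_slotsTetX_dn : ∀ δ ∈ fccOffsets, (slotsTetX.filter fun s => tetDnV s.2 - tetDnV s.1 = δ).card ≤ 1 := by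
  decide
/-- Fibre count: each offset at most once among lower in-plane octahedron slots. -/
theorem fiber_slotsOctLo : ∀ δ ∈ fccOffsets, (slotsOctLo.filter fun s => octV s.2 - octV s.1 = δ).card ≤ 1 := by
  decide
/-- Fibre count: each offset at most once among upper in-plane octahedron slots. -/
theorem fiber_slotsOctUp : ∀ δ ∈ fccOffsets, (slotsOctUp.filter fun s => octV s.2 - octV s.1 = δ).card ≤ 1 := by
  decide
/-- Fibre count: each offset at most twice among inter-layer octahedron slots. -/
theorem fiber_slotsOctX : ∀ δ ∈ fccOffsets, (slotsOctX.filter fun s => octV s.2 - octV s.1 = δ).card ≤ 2 := by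
  decide

/-- Slot differences are neighbour offsets (in-plane tetrahedron slots, up). -/
theorem tetUpIn_himg : ∀ s ∈ slotsTetIn, tetUpV s.2 - tetUpV s.1 ∈ fccOffsets :=
  fun s hs => tetUp_himg s (Finset.filter_subset _ _ hs)
/-- Slot differences are neighbour offsets (inter-layer tetrahedron slots, up). -/
theorem tetUpX_himg : ∀ s ∈ slotsTetX, tetUpV s.2 - tetUpV s.1 ∈ fccOffsets :=
  fun s hs => tetUp_himg s (Finset.filter_subset _ _ hs)
/-- Slot differences are neighbour offsets (in-plane tetrahedron slots, down). -/
theorem tetDnIn_himg : ∀ s ∈ slotsTetIn, tetDnV s.2 - tetDnV s.1 ∈ fccOffsets :=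
  fun s hs => tetDn_himg s (Finset.filter_subset _ _ hs)
/-- Slot differences are neighbour offsets (inter-layer tetrahedron slots, down). -/
theorem tetDnX_himg : ∀ s ∈ slotsTetX, tetDnV s.2 - tetDnV s.1 ∈ fccOffsets :=
  fun s hs => tetDn_himg s (Finset.filter_subset _ _ hs)
/-- Slot differences are neighbour offsets (lower octahedron slots). -/
theorem octLo_himg : ∀ s ∈ slotsOctLo, octV s.2 - octV s.1 ∈ fccOffsets :=
  fun s hs => oct_himg s (Finset.filter_subset _ _ hs)
/-- Slot differences are neighbour offsets (upper octahedron slots). -/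
theorem octUp_himg : ∀ s ∈ slotsOctUp, octV s.2 - octV s.1 ∈ fccOffsets :=
  fun s hs => oct_himg s (Finset.filter_subset _ _ hs)
/-- Slot differences are neighbour offsets (inter-layer octahedron slots). -/
theorem octX_himg : ∀ s ∈ slotsOctX, octV s.2 - octV s.1 ∈ fccOffsets :=
  fun s hs => oct_himg s (Finset.filter_subset _ _ hs)

/-! ## Splitting the occupied–vacant slot counts by layer type -/

/-- `ovSlots` of a filtered slot set is the filtered `ovSlots`. -/
theorem ovSlots_filter {n : ℕ} (v : Fin n → Site) (S : Finset (Fin n × Fin n)) (P : Fin n × Fin n → Prop)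
    [DecidablePred P] (A : Finset Site) (p : Site) :
    ovSlots v (S.filter P) A p = (ovSlots v S A p).filter P := by
  unfold ovSlots
  rw [Finset.filter_filter, Finset.filter_filter]
  congr 1; funext s; exact propext and_comm

/-- Tetrahedron slots split: `#ovSlots = #in-plane + #inter-layer`. -/
theorem card_ovSlots_tet_split (v : Fin 4 → Site) (A : Finset Site) (p : Site) :
    (ovSlots v slotsTet A p).card = (ovSlots v slotsTetIn A p).card + (ovSlots v slotsTetX A p).card := by
  rw [slotsTetIn, slotsTetX, ovSlots_filter, ovSlots_filter]
  exact (Finset.card_filter_add_card_filter_not _).symm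

/-- Octahedron slots split: `#ovSlots = #lower + #upper + #inter-layer`. -/
theorem card_ovSlots_oct_split (A : Finset Site) (p : Site) :
    (ovSlots octV slotsOct A p).card =
      (ovSlots octV slotsOctLo A p).card + (ovSlots octV slotsOctUp A p).card + (ovSlots octV slotsOctX A p).card := by
  classical
  rw [slotsOctLo, slotsOctUp, slotsOctX, ovSlots_filter, ovSlots_filter, ovSlots_filter]
  set T := ovSlots octV slotsOct A p
  have h1 : (T.filter fun s => octLayer s.1 = octLayer s.2).card + (T.filter fun s => octLayer s.1 ≠ octLayer s.2).card = T.card :=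
    Finset.card_filter_add_card_filter_not _
  have hval : ∀ i : Fin 6, octLayer i = 0 ∨ octLayer i = 1 := by decide
  have h2 : (T.filter fun s => octLayer s.1 = octLayer s.2) =
      (T.filter fun s => octLayer s.1 = 0 ∧ octLayer s.2 = 0) ∪ (T.filter fun s => octLayer s.1 = 1 ∧ octLayer s.2 = 1) := by
    ext s
    simp only [Finset.mem_filter, Finset.mem_union]
    constructor
    · rintro ⟨hs, he⟩
      rcases hval s.1 with h | h
      · exact Or.inl ⟨hs, h, by rw [← he, h]⟩
      · exact Or.inr ⟨hs, h, by rw [← he, h]⟩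
    · rintro (⟨hs, h1, h2⟩ | ⟨hs, h1, h2⟩) <;> exact ⟨hs, by rw [h1, h2]⟩
  have hdisj : Disjoint (T.filter fun s => octLayer s.1 = 0 ∧ octLayer s.2 = 0)
      (T.filter fun s => octLayer s.1 = 1 ∧ octLayer s.2 = 1) := by
    rw [Finset.disjoint_filter]; rintro s _ ⟨h, -⟩ ⟨h', -⟩; rw [h] at h'; exact zero_ne_one h'
  rw [h2, Finset.card_union_of_disjoint hdisj] at h1
  omega

/-! ## The refined table -/

/-- **The bilayer form of (T1)**: for every finite `A` and every three cell families, the tent cost is at most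
`2·#covered(T⁺, in-plane) + 2·#covered(T⁺, inter) + 2·#covered(T⁻, in-plane) + 2·#covered(T⁻, inter) +
4·#covered(O, lower) + 4·#covered(O, upper) + 8·#covered(O, inter)` (units of `1/24`). -/
theorem tentCostOn24_le_split (A U D O : Finset Site) :
    tentCostOn24 A U D O ≤
      2 * ((covered tetUpV slotsTetIn A U).card : ℤ) + 2 * ((covered tetUpV slotsTetX A U).card : ℤ) +
      2 * ((covered tetDnV slotsTetIn A D).card : ℤ) + 2 * ((covered tetDnV slotsTetX A D).card : ℤ) +
      4 * ((covered octV slotsOctLo A O).card : ℤ) + 4 * ((covered octV slotsOctUp A O).card : ℤ) +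
      8 * ((covered octV slotsOctX A O).card : ℤ) := by
  classical
  have hU : ∑ p ∈ U, eTetUp A p ≤ ((covered tetUpV slotsTetIn A U).card : ℤ) + (covered tetUpV slotsTetX A U).card := by
    have h1 := sum_card_ovSlots_le tetUpV slotsTetIn 1 fiber_slotsTetIn_up tetUpIn_himg A U
    have h2 := sum_card_ovSlots_le tetUpV slotsTetX 1 fiber_slotsTetX_up tetUpX_himg A U
    simp_rw [eTetUp_eq_card, card_ovSlots_tet_split]
    push_cast
    rw [Finset.sum_add_distrib, ← Nat.cast_sum, ← Nat.cast_sum]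
    have := Nat.add_le_add h1 h2
    rw [one_mul, one_mul] at this
    exact_mod_cast this
  have hD : ∑ p ∈ D, eTetDn A p ≤ ((covered tetDnV slotsTetIn A D).card : ℤ) + (covered tetDnV slotsTetX A D).card := by
    have h1 := sum_card_ovSlots_le tetDnV slotsTetIn 1 fiber_slotsTetIn_dn tetDnIn_himg A D
    have h2 := sum_card_ovSlots_le tetDnV slotsTetX 1 fiber_slotsTetX_dn tetDnX_himg A D
    simp_rw [eTetDn_eq_card, card_ovSlots_tet_split]
    push_cast
    rw [Finset.sum_add_distrib, ← Nat.cast_sum, ← Nat.cast_sum]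
    have := Nat.add_le_add h1 h2
    rw [one_mul, one_mul] at this
    exact_mod_cast this
  have hO : ∑ p ∈ O, eOct A p ≤ ((covered octV slotsOctLo A O).card : ℤ) + (covered octV slotsOctUp A O).card +
      2 * (covered octV slotsOctX A O).card := by
    have h1 := sum_card_ovSlots_le octV slotsOctLo 1 fiber_slotsOctLo octLo_himg A O
    have h2 := sum_card_ovSlots_le octV slotsOctUp 1 fiber_slotsOctUp octUp_himg A O
    have h3 := sum_card_ovSlots_le octV slotsOctX 2 fiber_slotsOctX octX_himg A O
    simp_rw [eOct_eq_card, card_ovSlots_oct_split]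
    push_cast
    rw [Finset.sum_add_distrib, Finset.sum_add_distrib, ← Nat.cast_sum, ← Nat.cast_sum, ← Nat.cast_sum]
    have := Nat.add_le_add (Nat.add_le_add h1 h2) h3
    rw [one_mul, one_mul] at this
    exact_mod_cast this
  have hO' : ∑ p ∈ O, octCost24 (patO A p) ≤ ∑ p ∈ O, 4 * eOct A p :=
    sum_le_sum fun p _ => by rw [← eOVb_patO]; exact oct_table _
  unfold tentCostOn24
  rw [← mul_sum, ← mul_sum]
  rw [← mul_sum] at hO'
  linarith

/-! ## The bilayer currency: in-plane and inter-layer broken bonds of the bilayer `(0, 1)` near a set -/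

/-- In-plane ordered broken bonds of `X` in the layers `0` and `1` whose occupied end is within `√2` of `V`. -/
def brokenNearIP (X : Finset Site) (V : Set (EuclideanSpace ℝ (Fin 3))) : Set (Site × Site) :=
  {q | q.1 ∈ X ∧ q.2 ∈ fccOffsets ∧ q.1 + q.2 ∉ X ∧ Metric.infDist (site q.1) V ≤ Real.sqrt 2 ∧
    lay (q.1 + q.2) = lay q.1 ∧ (lay q.1 = 0 ∨ lay q.1 = 1)}

/-- Inter-layer ordered broken bonds of `X` between the layers `0` and `1` whose occupied end is within `√2` of `V`. -/
def brokenNearIL (X : Finset Site) (V : Set (EuclideanSpace ℝ (Fin 3))) : Set (Site × Site) :=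
  {q | q.1 ∈ X ∧ q.2 ∈ fccOffsets ∧ q.1 + q.2 ∉ X ∧ Metric.infDist (site q.1) V ≤ Real.sqrt 2 ∧
    ((lay q.1 = 0 ∧ lay (q.1 + q.2) = 1) ∨ (lay q.1 = 1 ∧ lay (q.1 + q.2) = 0))}

/-- The in-plane currency set is finite. -/
theorem brokenNearIP_finite (X : Finset Site) (V : Set (EuclideanSpace ℝ (Fin 3))) : (brokenNearIP X V).Finite := by
  refine (Finset.finite_toSet (X ×ˢ fccOffsets)).subset ?_
  rintro q ⟨h1, h2, -⟩
  exact Finset.mem_coe.2 (Finset.mem_product.2 ⟨h1, h2⟩)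

/-- The inter-layer currency set is finite. -/
theorem brokenNearIL_finite (X : Finset Site) (V : Set (EuclideanSpace ℝ (Fin 3))) : (brokenNearIL X V).Finite := by
  refine (Finset.finite_toSet (X ×ˢ fccOffsets)).subset ?_
  rintro q ⟨h1, h2, -⟩
  exact Finset.mem_coe.2 (Finset.mem_product.2 ⟨h1, h2⟩)

/-- Generic step: a slot pair of a cell whose occupied end is within `√2` of a point of `V` is a broken bond near
`V`, with the layers of its ends read off the anchor and the slots. -/
theorem covered_mem_aux {X : Finset Site} {V : Set (EuclideanSpace ℝ (Fin 3))} (p v1 v2 : Site)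
    {y : EuclideanSpace ℝ (Fin 3)} (hyV : y ∈ V) (h1 : p + v1 ∈ X) (h2 : p + v2 ∉ X)
    (hδ : v2 - v1 ∈ fccOffsets) (hd : dist (site (p + v1)) y ≤ Real.sqrt 2) :
    (p + v1, v2 - v1).1 ∈ X ∧ (p + v1, v2 - v1).2 ∈ fccOffsets ∧ (p + v1, v2 - v1).1 + (p + v1, v2 - v1).2 ∉ X ∧
      Metric.infDist (site (p + v1, v2 - v1).1) V ≤ Real.sqrt 2 ∧
      lay (p + v1, v2 - v1).1 = lay p + lay v1 ∧ lay ((p + v1, v2 - v1).1 + (p + v1, v2 - v1).2) = lay p + lay v2 := by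
  refine ⟨h1, hδ, by rw [show p + v1 + (v2 - v1) = p + v2 by abel]; exact h2,
    le_trans (Metric.infDist_le_dist_of_mem hyV) hd, lay_add p v1, ?_⟩
  rw [show p + v1 + (v2 - v1) = p + v2 by abel, lay_add]

/-- **In-plane covered bonds of the slab-`0` families in the UPPER layer** (up-tetrahedra and upper octahedron
faces) are in-plane broken bonds of the bilayer near `V` with occupied end in layer `1`. -/
theorem covered_inPlane_subset_one (X : Finset Site) (V : Set (EuclideanSpace ℝ (Fin 3))) (Pup PO : Finset Site)
    (hup : ∀ p ∈ Pup, lay p = 0 ∧ (closedChamber (labelUp p).1 (labelUp p).2 ∩ V).Nonempty)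
    (hO : ∀ p ∈ PO, lay p = 0 ∧ ∃ s : Fin 3 → Bool, (closedChamber (labelCorner p s).1 (labelCorner p s).2 ∩ V).Nonempty) :
    ((covered tetUpV slotsTetIn X Pup ∪ covered octV slotsOctUp X PO : Finset (Site × Site)) : Set (Site × Site)) ⊆
      {q | q ∈ brokenNearIP X V ∧ lay q.1 = 1} := by
  intro q hq
  rw [Finset.mem_coe, Finset.mem_union] at hq
  rcases hq with hq | hq
  · obtain ⟨p, hp, s, hs, h1, h2, rfl⟩ := (mem_covered tetUpV slotsTetIn).1 hq
    obtain ⟨hl, y, hy, hyV⟩ := hup p hp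
    have hs' := (Finset.mem_filter.1 hs).2
    obtain ⟨a, b, c, d, e, f⟩ := covered_mem_aux p _ _ hyV h1 h2 (tetUpIn_himg s hs)
      (dist_le_sqrt2_of_mem_closedChamber (site_tetUpV_mem_closedChamber p s.1) hy)
    have h1' : lay (p + tetUpV s.1, tetUpV s.2 - tetUpV s.1).1 = 1 := by
      rw [e, lay_tetUpV, if_neg hs'.1, hl]; norm_num
    refine ⟨⟨a, b, c, d, ?_, Or.inr h1'⟩, h1'⟩
    rw [f, e, lay_tetUpV, lay_tetUpV, if_neg hs'.1, if_neg hs'.2]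
  · obtain ⟨p, hp, s, hs, h1, h2, rfl⟩ := (mem_covered octV slotsOctUp).1 hq
    obtain ⟨hl, s₀, y, hy, hyV⟩ := hO p hp
    have hs' := (Finset.mem_filter.1 hs).2
    obtain ⟨a, b, c, d, e, f⟩ := covered_mem_aux p _ _ hyV h1 h2 (octUp_himg s hs) (dist_octV_le_sqrt2 p s₀ hy s.1)
    have h1' : lay (p + octV s.1, octV s.2 - octV s.1).1 = 1 := by
      rw [e, lay_octV, hs'.1, hl]; norm_num
    refine ⟨⟨a, b, c, d, ?_, Or.inr h1'⟩, h1'⟩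
    rw [f, e, lay_octV, lay_octV, hs'.1, hs'.2]

/-- **In-plane covered bonds of the slab-`0` families in the LOWER layer** (down-tetrahedra and lower octahedron
faces) are in-plane broken bonds of the bilayer near `V` with occupied end in layer `0`. -/
theorem covered_inPlane_subset_zero (X : Finset Site) (V : Set (EuclideanSpace ℝ (Fin 3))) (Pdn PO : Finset Site)
    (hdn : ∀ p ∈ Pdn, lay p = 1 ∧ (closedChamber (labelDn p).1 (labelDn p).2 ∩ V).Nonempty)
    (hO : ∀ p ∈ PO, lay p = 0 ∧ ∃ s : Fin 3 → Bool, (closedChamber (labelCorner p s).1 (labelCorner p s).2 ∩ V).Nonempty) :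
    ((covered tetDnV slotsTetIn X Pdn ∪ covered octV slotsOctLo X PO : Finset (Site × Site)) : Set (Site × Site)) ⊆
      {q | q ∈ brokenNearIP X V ∧ lay q.1 = 0} := by
  intro q hq
  rw [Finset.mem_coe, Finset.mem_union] at hq
  rcases hq with hq | hq
  · obtain ⟨p, hp, s, hs, h1, h2, rfl⟩ := (mem_covered tetDnV slotsTetIn).1 hq
    obtain ⟨hl, y, hy, hyV⟩ := hdn p hp
    have hs' := (Finset.mem_filter.1 hs).2
    obtain ⟨a, b, c, d, e, f⟩ := covered_mem_aux p _ _ hyV h1 h2 (tetDnIn_himg s hs)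
      (dist_le_sqrt2_of_mem_closedChamber (site_tetDnV_mem_closedChamber p s.1) hy)
    have h1' : lay (p + tetDnV s.1, tetDnV s.2 - tetDnV s.1).1 = 0 := by
      rw [e, lay_tetDnV, if_neg hs'.1, hl]; norm_num
    refine ⟨⟨a, b, c, d, ?_, Or.inl h1'⟩, h1'⟩
    rw [f, e, lay_tetDnV, lay_tetDnV, if_neg hs'.1, if_neg hs'.2]
  · obtain ⟨p, hp, s, hs, h1, h2, rfl⟩ := (mem_covered octV slotsOctLo).1 hq
    obtain ⟨hl, s₀, y, hy, hyV⟩ := hO p hp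
    have hs' := (Finset.mem_filter.1 hs).2
    obtain ⟨a, b, c, d, e, f⟩ := covered_mem_aux p _ _ hyV h1 h2 (octLo_himg s hs) (dist_octV_le_sqrt2 p s₀ hy s.1)
    have h1' : lay (p + octV s.1, octV s.2 - octV s.1).1 = 0 := by
      rw [e, lay_octV, hs'.1, hl]; norm_num
    refine ⟨⟨a, b, c, d, ?_, Or.inl h1'⟩, h1'⟩
    rw [f, e, lay_octV, lay_octV, hs'.1, hs'.2]

/-- **Inter-layer covered bonds of the slab-`0` families are inter-layer broken bonds of the bilayer near `V`.** -/
theorem covered_inter_subset (X : Finset Site) (V : Set (EuclideanSpace ℝ (Fin 3))) (Pup Pdn PO : Finset Site)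
    (hup : ∀ p ∈ Pup, lay p = 0 ∧ (closedChamber (labelUp p).1 (labelUp p).2 ∩ V).Nonempty)
    (hdn : ∀ p ∈ Pdn, lay p = 1 ∧ (closedChamber (labelDn p).1 (labelDn p).2 ∩ V).Nonempty)
    (hO : ∀ p ∈ PO, lay p = 0 ∧ ∃ s : Fin 3 → Bool, (closedChamber (labelCorner p s).1 (labelCorner p s).2 ∩ V).Nonempty) :
    ((covered tetUpV slotsTetX X Pup ∪ covered tetDnV slotsTetX X Pdn ∪ covered octV slotsOctX X PO :
      Finset (Site × Site)) : Set (Site × Site)) ⊆ brokenNearIL X V := by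
  intro q hq
  rw [Finset.mem_coe, Finset.mem_union, Finset.mem_union] at hq
  rcases hq with (hq | hq) | hq
  · obtain ⟨p, hp, s, hs, h1, h2, rfl⟩ := (mem_covered tetUpV slotsTetX).1 hq
    obtain ⟨hl, y, hy, hyV⟩ := hup p hp
    have hs0 := (Finset.mem_filter.1 (Finset.mem_filter.1 hs).1).2
    have hs' := (Finset.mem_filter.1 hs).2
    obtain ⟨a, b, c, d, e, f⟩ := covered_mem_aux p _ _ hyV h1 h2 (tetUpX_himg s hs)
      (dist_le_sqrt2_of_mem_closedChamber (site_tetUpV_mem_closedChamber p s.1) hy)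
    refine ⟨a, b, c, d, ?_⟩
    rw [e, f, lay_tetUpV, lay_tetUpV, hl]
    by_cases h0 : s.1 = 0
    · have h2' : s.2 ≠ 0 := fun h => hs0 (h0.trans h.symm)
      left; simp [h0, h2']
    · have h2' : s.2 = 0 := by by_contra h; exact hs' ⟨h0, h⟩
      right; simp [h0, h2']
  · obtain ⟨p, hp, s, hs, h1, h2, rfl⟩ := (mem_covered tetDnV slotsTetX).1 hq
    obtain ⟨hl, y, hy, hyV⟩ := hdn p hp
    have hs0 := (Finset.mem_filter.1 (Finset.mem_filter.1 hs).1).2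
    have hs' := (Finset.mem_filter.1 hs).2
    obtain ⟨a, b, c, d, e, f⟩ := covered_mem_aux p _ _ hyV h1 h2 (tetDnX_himg s hs)
      (dist_le_sqrt2_of_mem_closedChamber (site_tetDnV_mem_closedChamber p s.1) hy)
    refine ⟨a, b, c, d, ?_⟩
    rw [e, f, lay_tetDnV, lay_tetDnV, hl]
    by_cases h0 : s.1 = 0
    · have h2' : s.2 ≠ 0 := fun h => hs0 (h0.trans h.symm)
      right; simp [h0, h2']
    · have h2' : s.2 = 0 := by by_contra h; exact hs' ⟨h0, h⟩
      left; simp [h0, h2']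
  · obtain ⟨p, hp, s, hs, h1, h2, rfl⟩ := (mem_covered octV slotsOctX).1 hq
    obtain ⟨hl, s₀, y, hy, hyV⟩ := hO p hp
    have hs' := (Finset.mem_filter.1 hs).2
    obtain ⟨a, b, c, d, e, f⟩ := covered_mem_aux p _ _ hyV h1 h2 (octX_himg s hs) (dist_octV_le_sqrt2 p s₀ hy s.1)
    refine ⟨a, b, c, d, ?_⟩
    rw [e, f, lay_octV, lay_octV, hl, zero_add, zero_add]
    have hval : ∀ i : Fin 6, octLayer i = 0 ∨ octLayer i = 1 := by decide
    rcases hval s.1 with h | h <;> rcases hval s.2 with h' | h'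
    · exact absurd (h.trans h'.symm) hs'
    · exact Or.inl ⟨h, h'⟩
    · exact Or.inr ⟨h, h'⟩
    · exact absurd (h.trans h'.symm) hs'

/-- **The bilayer currency bound.**  For cell families of the slab `(0,1)` whose closed cells meet `V`:
`tentCostOn24 ≤ 6 · (#IP + 2 · #IL)` in units of `1/24`, i.e. the cost is at most `¼ #IP + ½ #IL`. -/
theorem tentCostOn24_le_six_mul (X : Finset Site) (V : Set (EuclideanSpace ℝ (Fin 3))) (Pup Pdn PO : Finset Site)
    (hup : ∀ p ∈ Pup, lay p = 0 ∧ (closedChamber (labelUp p).1 (labelUp p).2 ∩ V).Nonempty)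
    (hdn : ∀ p ∈ Pdn, lay p = 1 ∧ (closedChamber (labelDn p).1 (labelDn p).2 ∩ V).Nonempty)
    (hO : ∀ p ∈ PO, lay p = 0 ∧ ∃ s : Fin 3 → Bool, (closedChamber (labelCorner p s).1 (labelCorner p s).2 ∩ V).Nonempty) :
    (tentCostOn24 X Pup Pdn PO : ℝ) ≤
      6 * (((brokenNearIP X V).ncard : ℝ) + 2 * ((brokenNearIL X V).ncard : ℝ)) := by
  classical
  have hsplit := tentCostOn24_le_split X Pup Pdn PO
  have hI1 := covered_inPlane_subset_one X V Pup PO hup hO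
  have hI0 := covered_inPlane_subset_zero X V Pdn PO hdn hO
  have hIL := covered_inter_subset X V Pup Pdn PO hup hdn hO
  set S1 : Set (Site × Site) := {q | q ∈ brokenNearIP X V ∧ lay q.1 = 1} with hS1
  set S0 : Set (Site × Site) := {q | q ∈ brokenNearIP X V ∧ lay q.1 = 0} with hS0
  have hfin := brokenNearIP_finite X V
  have hS1f : S1.Finite := hfin.subset fun q hq => hq.1
  have hS0f : S0.Finite := hfin.subset fun q hq => hq.1
  have hsum : S0.ncard + S1.ncard ≤ (brokenNearIP X V).ncard := by
    rw [← Set.ncard_union_eq (Set.disjoint_left.2 fun q h0 h1 => by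
      have := h0.2.symm.trans h1.2; exact zero_ne_one this) hS0f hS1f]
    exact Set.ncard_le_ncard (Set.union_subset (fun q hq => hq.1) (fun q hq => hq.1)) hfin
  have cS : ∀ (T : Finset (Site × Site)) (S : Set (Site × Site)), S.Finite → (↑T : Set (Site × Site)) ⊆ S →
      T.card ≤ S.ncard :=
    fun T S hS hT => by rw [← Set.ncard_coe_finset]; exact Set.ncard_le_ncard hT hS
  have s1 : (covered tetUpV slotsTetIn X Pup).card ≤ S1.ncard :=
    cS _ _ hS1f (subset_trans (by intro q hq; simp_all) hI1)
  have s4 : (covered octV slotsOctUp X PO).card ≤ S1.ncard :=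
    cS _ _ hS1f (subset_trans (by intro q hq; simp_all) hI1)
  have s2 : (covered tetDnV slotsTetIn X Pdn).card ≤ S0.ncard :=
    cS _ _ hS0f (subset_trans (by intro q hq; simp_all) hI0)
  have s3 : (covered octV slotsOctLo X PO).card ≤ S0.ncard :=
    cS _ _ hS0f (subset_trans (by intro q hq; simp_all) hI0)
  have t1 : (covered tetUpV slotsTetX X Pup).card ≤ (brokenNearIL X V).ncard :=
    cS _ _ (brokenNearIL_finite X V) (subset_trans (by intro q hq; simp_all) hIL)
  have t2 : (covered tetDnV slotsTetX X Pdn).card ≤ (brokenNearIL X V).ncard :=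
    cS _ _ (brokenNearIL_finite X V) (subset_trans (by intro q hq; simp_all) hIL)
  have t3 : (covered octV slotsOctX X PO).card ≤ (brokenNearIL X V).ncard :=
    cS _ _ (brokenNearIL_finite X V) (subset_trans (by intro q hq; simp_all) hIL)
  have hsplitR := (Int.cast_le (R := ℝ)).2 hsplit
  push_cast at hsplitR
  have hsumR : (S0.ncard : ℝ) + S1.ncard ≤ (brokenNearIP X V).ncard := by exact_mod_cast hsum
  have s1' : ((covered tetUpV slotsTetIn X Pup).card : ℝ) ≤ S1.ncard := by exact_mod_cast s1
  have s2' : ((covered tetDnV slotsTetIn X Pdn).card : ℝ) ≤ S0.ncard := by exact_mod_cast s2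
  have s3' : ((covered octV slotsOctLo X PO).card : ℝ) ≤ S0.ncard := by exact_mod_cast s3
  have s4' : ((covered octV slotsOctUp X PO).card : ℝ) ≤ S1.ncard := by exact_mod_cast s4
  have t1' : ((covered tetUpV slotsTetX X Pup).card : ℝ) ≤ (brokenNearIL X V).ncard := by exact_mod_cast t1
  have t2' : ((covered tetDnV slotsTetX X Pdn).card : ℝ) ≤ (brokenNearIL X V).ncard := by exact_mod_cast t2
  have t3' : ((covered octV slotsOctX X PO).card : ℝ) ≤ (brokenNearIL X V).ncard := by exact_mod_cast t3
  linarith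

end Summit.Ventures.Crystal3D.TentCertificate

end
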